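import Summits.QuantumFields.YangMills.Theorems.LuscherReductionRunningReductionOneSiteTailFloor
import Summits.QuantumFields.YangMills.Theorems.LuscherReductionRunningReductionOneSiteTailSockets
import Mathlib.Analysis.SpecialFunctions.Pow.Asymptotics

/-!
# Route `LuscherReduction` — support item `OneSiteTail` (stmt-QuantumFields-20204, child of crux RED `RunningReduction`): CLOSED

`Summit.QuantumFields.YangMills.Theses.LuscherReduction.OneSiteTail` (route rev 12; = the registered stub `TT.stub_oneSiteTail` of skeleton «KTR» rev 8
PART 8): the B-UNIFORM tail of the one-site femto heat trace, `∀ s>0 ∀ ε>0 ∃ K B0, ∀ B ≥ B0 ∀ T, s ≤ 2Tλ_b → Summable (x_k^T) ∧ Σ' x_{k+K}^T ≤ ε`,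
`x_k = λ_k(B)/λ_0(B)`.

Assembly (two fleet seats, plan of record = STUB-READING of ym-cruxidea-19978-2 g10):
* S1 — the polynomial Hilbert–Schmidt ratio `Σ_{j<n} x_j² ≤ C·B⁹` (`OST.hs_ratio`, this seat; socket form `OSTail.hsRatio_range` by ym-luscher-20007-p2 g4);
* S2 — the B-UNIFORM WINDOW FLOOR in level currency, `16E + C₀ < physLevel (k+1) ⟹ λ_k ≤ e^{−Eλ_b}λ_0` for `Eλ_b ≤ B^{−1/4}/8000` (`OST.window_floor`, this
  seat: ONE's AbsUpper lane in subspace mode — `outer_uniform`, `cos_piece_of_window_onePhase`, `jump_le_of_qform_ge`, `flat_energy_of_jump_le`,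
  `physLevel_le_of_kacFamily`, `physLevel_le_of_highFamily`), repackaged here as the windowed Laplace-summable floor `windowFloor_all`
  (profile `g(k) = max 0 (E_{k+1} − C₀)/32`, log windows admissible since `log B·λ_b ≪ B^{−1/4}`, `log_mul_bareLambda_le`);
* GLUE — `OSTail.oneSiteTail_route_of_windowFloor` (seat ym-luscher-20007-p2 g4: trace bound from HS + floor, `LGS.levelGapSummable`, the route decl by name).

HONEST FRAMING: one-site (`L = 1`) lattice-QM → continuum-QM bookkeeping on the femto rung R2b1 (input `OneSiteTail` of the TT door of crux RED); proves
nothing of the RG statement `TwistedTraceScaling` or of `DressedRitz`; not infinite volume, not a mass gap, not Clay.  Sorry-free; no new definitions,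
no named-fact hypotheses.
-/

set_option autoImplicit false

noncomputable section

open MeasureTheory Filter Topology Real Asymptotics
open scoped BigOperators
open Literature.MathematicalPhysics.QuantumFieldTheory
open Literature.MathematicalPhysics.QuantumLattice
open Literature.Analysis.OperatorTheory.YMMatrixModel

namespace Summit.QuantumFields.YangMills.Theorems.FemtoTransferGap.OST

open Summit.QuantumFields.YangMills.Theorems.FemtoTransferGap

/-! ### §1. Logarithmic windows are admissible: `log B · λ_b(B) ≤ c·B^{−1/4}` eventually -/

/-- For every `c > 0`: `log B · λ_b(B) ≤ c·B^{−1/4}` for all large `B` (`λ_b = 2^{1/3}B^{−1/3}`, `log B = o(B^{1/12})`). [folklore] -/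
theorem log_mul_bareLambda_le {c : ℝ} (hc : 0 < c) :
    ∃ T : ℝ, 1 ≤ T ∧ ∀ B : ℝ, T ≤ B → Real.log B * bareLambda B ≤ c * B ^ (-(1 / 4 : ℝ)) := by
  have h2 : 0 < (2 : ℝ) ^ ((1 : ℝ) / 3) := by positivity
  have ho := (isLittleO_log_rpow_atTop (show (0 : ℝ) < 1 / 12 by norm_num)).bound (div_pos hc h2)
  obtain ⟨T₀, hT₀⟩ := Filter.eventually_atTop.1 ho
  refine ⟨max T₀ 1, le_max_right _ _, fun B hB => ?_⟩
  have hB1 : 1 ≤ B := (le_max_right _ _).trans hB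
  have hBpos : 0 < B := by linarith
  have h := hT₀ B ((le_max_left _ _).trans hB)
  rw [Real.norm_of_nonneg (Real.log_nonneg hB1), Real.norm_of_nonneg (Real.rpow_nonneg hBpos.le _)] at h
  rw [bareLambda_eq_rpow hBpos]
  have hsplit : B ^ (-(1 / 4 : ℝ)) = B ^ ((1 : ℝ) / 12) * B ^ (-(1 : ℝ) / 3) := by
    rw [← Real.rpow_add hBpos]; norm_num
  have h3 : 0 < B ^ (-(1 : ℝ) / 3) := Real.rpow_pos_of_pos hBpos _
  calc Real.log B * ((2 : ℝ) ^ ((1 : ℝ) / 3) * B ^ (-(1 : ℝ) / 3))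
      = (Real.log B) * (2 : ℝ) ^ ((1 : ℝ) / 3) * B ^ (-(1 : ℝ) / 3) := by ring
    _ ≤ (c / (2 : ℝ) ^ ((1 : ℝ) / 3) * B ^ ((1 : ℝ) / 12)) * (2 : ℝ) ^ ((1 : ℝ) / 3) * B ^ (-(1 : ℝ) / 3) :=
        mul_le_mul_of_nonneg_right (mul_le_mul_of_nonneg_right h h2.le) h3.le
    _ = c * B ^ (-(1 / 4 : ℝ)) := by rw [hsplit]; field_simp

/-! ### §2. S2 in the currency of the glue socket -/

/-- **S2 in socket form (windowed Laplace-summable floor)**: for every `c₁ > 0` there are a profile `g ≥ 0` with `Σ_k e^{−t g(k)} < ∞` for all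
`t > 0` (here `g(k) = max(0, E_{k+1} − C₀)/32`) and `B0` such that `λ_k(B) ≤ exp(−λ_b·min(g(k), c₁ log B))·λ_0(B)` for all `B ≥ B0` and ALL `k`.
[cite: SimonB1983DiscreteSpectrum, Cor. 4] [cite: Luscher1983, §2–§3] -/
theorem windowFloor_all : ∀ c₁ : ℝ, 0 < c₁ → ∃ g : ℕ → ℝ, (∀ k, 0 ≤ g k) ∧
      (∀ t : ℝ, 0 < t → Summable fun k : ℕ => Real.exp (-t * g k)) ∧
      ∃ B0 : ℝ, ∀ B : ℝ, B0 ≤ B → ∀ k : ℕ,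
        levelValue su2Rep 1 B k ≤ Real.exp (-(bareLambda B * min (g k) (c₁ * Real.log B))) * levelValue su2Rep 1 B 0 := by
  intro c₁ hc₁
  obtain ⟨B0, C₀, hw⟩ := window_floor
  obtain ⟨TL, hTL1, hTL⟩ := log_mul_bareLambda_le (c := 1 / (8000 * c₁)) (by positivity)
  refine ⟨fun k => (1 / 32 : ℝ) * max 0 (physLevel (k + 1) - C₀), fun k => mul_nonneg (by norm_num) (le_max_left _ _),
    fun t ht => ?_, max (max B0 TL) 1, fun B hB k => ?_⟩
  · have h := OSTail.summable_exp_neg_mul_physLevel_shift C₀ (t / 32) (by positivity)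
    refine h.congr fun k => ?_
    congr 1; ring
  have hB0 : B0 ≤ B := ((le_max_left _ _).trans (le_max_left _ _)).trans hB
  have hBTL : TL ≤ B := ((le_max_right _ _).trans (le_max_left _ _)).trans hB
  have hB1 : 1 ≤ B := (le_max_right _ _).trans hB
  have hBpos : 0 < B := by linarith
  have hlog : 0 ≤ Real.log B := Real.log_nonneg hB1
  show levelValue su2Rep 1 B k ≤
    Real.exp (-(bareLambda B * min ((1 / 32 : ℝ) * max 0 (physLevel (k + 1) - C₀)) (c₁ * Real.log B))) * levelValue su2Rep 1 B 0
  set m : ℝ := min ((1 / 32 : ℝ) * max 0 (physLevel (k + 1) - C₀)) (c₁ * Real.log B) with hm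
  have hm0 : 0 ≤ m := le_min (mul_nonneg (by norm_num) (le_max_left _ _)) (mul_nonneg hc₁.le hlog)
  rcases eq_or_lt_of_le hm0 with hmz | hmpos
  · rw [← hmz, mul_zero, neg_zero, Real.exp_zero, one_mul]
    exact levelValue_le_of_le (L := 1) hBpos (Nat.zero_le k)
  · -- the level is above `C₀`, and `m` is an admissible window energy with `16 m + C₀ < E_{k+1}`
    have hEk : C₀ < physLevel (k + 1) := by
      by_contra hle
      push Not at hle
      have h0 : max 0 (physLevel (k + 1) - C₀) = 0 := max_eq_left (by linarith)
      have : m ≤ 0 := by rw [hm, h0, mul_zero]; exact min_le_left _ _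
      linarith
    have hmax : max 0 (physLevel (k + 1) - C₀) = physLevel (k + 1) - C₀ := max_eq_right (by linarith)
    have hmE : 16 * m + C₀ < physLevel (k + 1) := by
      have h1 : m ≤ (1 / 32 : ℝ) * (physLevel (k + 1) - C₀) := by rw [← hmax]; exact min_le_left _ _
      linarith
    have hmw : m * bareLambda B ≤ 1 / 8000 * B ^ (-(1 / 4 : ℝ)) := by
      have h1 : m ≤ c₁ * Real.log B := min_le_right _ _
      have h2 := hTL B hBTL
      have ht0 : 0 ≤ bareLambda B := (bareLambda_pos' hBpos).le
      calc m * bareLambda B ≤ c₁ * Real.log B * bareLambda B := mul_le_mul_of_nonneg_right h1 ht0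
        _ = c₁ * (Real.log B * bareLambda B) := by ring
        _ ≤ c₁ * (1 / (8000 * c₁) * B ^ (-(1 / 4 : ℝ))) := mul_le_mul_of_nonneg_left h2 hc₁.le
        _ = 1 / 8000 * B ^ (-(1 / 4 : ℝ)) := by field_simp
    have h := hw B hB0 m hmpos.le hmw k hmE
    rwa [mul_comm m (bareLambda B)] at h

/-! ### §3. The item -/

/-- ★★★ **Item stmt-QuantumFields-20204: the route decl `Summit.QuantumFields.YangMills.Theses.LuscherReduction.OneSiteTail` holds** — the B-uniform tail of
the one-site femto heat trace (S1 `OST.hs_ratio`/`OSTail.hsRatio_range` + S2 `windowFloor_all` through the glue `OSTail.oneSiteTail_route_of_windowFloor`).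
[cite: Luscher1983, §1–§3] [cite: SimonB1983DiscreteSpectrum, Cor. 4] [cite: ReedSimonIV1978, Thm. XIII.1] -/
theorem oneSiteTail_proof : Summit.QuantumFields.YangMills.Theses.LuscherReduction.OneSiteTail :=
  OSTail.oneSiteTail_route_of_windowFloor windowFloor_all

end Summit.QuantumFields.YangMills.Theorems.FemtoTransferGap.OST

end
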